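import Literature.Analysis.FluidPDE.PlanarCornerMotion
import HarnessLib

/-!
# The band of a corner: the tent profile is within `ρ/3` of the ideal corner

Topic `Literature/Analysis/FluidPDE`. Helper file of the explicit pullback calculus for the planar
transport equation. The scalar of a (moving rigid) corner element is supported where
`|v - T(t,u)| < κ ω_ref`, a band around the smoothed tent `v = T(u)` in the diagonal frame. For
the checks of a design (order conditions on the band, the cover) this band must be controlled by
simple sets. The tent profile `tent(u) = (u - a) + c - 2 rampAt a ρ u` lies between the IDEAL
corner `min (c + (u - a)) (c + ρ - (u - a))` (the two straight arms) and that ideal corner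
lowered by `ρ/3` (`tentProfile_le_min`, `min_sub_le_tentProfile`, from the bounds on `stepRamp`).
Consequently a point of the band `|v - T| ≤ w` lies in one of two TRUNCATED STRAIGHT STRIPS of
half-width `w + ρ/3` around the two arms (`tent_band_subset`), which in physical coordinates are
a horizontal and a vertical strip meeting at the vertex (`corner_band_subset`, and
`movingCorner_band_subset` for the translated corner) — plain linear inequalities.

Folklore; no named facts. Infrastructure towards a discharge of `acm_compatible_blocks`
(`QuasiSelfSimilarCompatibleBlocks.lean`).

## References

* G. Alberti, G. Crippa, A. L. Mazzucato, *Exponential self-similar mixing by incompressible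
  flows*, J. Amer. Math. Soc. 32 (2019), 445–490, §7 (arXiv:1605.02090).
-/

noncomputable section

open Function Set Filter
open scoped Topology ContDiff

namespace Literature.Analysis.FluidPDE

namespace PlanarKinematics

open Gluing

/-- The plane `ℝ²` as a Euclidean space. [folklore] -/
local notation "E²" => EuclideanSpace ℝ (Fin 2)

/-! ## Bounds on the tent profile -/

/-- `2 rampAt a ρ x ≥ max (2 (x - a) - ρ) 0`. [folklore] -/
theorem max_le_two_mul_rampAt {a ρ : ℝ} (hρ : 0 < ρ) (x : ℝ) : max (2 * (x - a) - ρ) 0 ≤ 2 * rampAt a ρ x := by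
  rw [rampAt_apply]
  have h1 := sub_half_le_stepRamp ((x - a) / ρ)
  have h2 := stepRamp_nonneg ((x - a) / ρ)
  refine max_le ?_ (by positivity)
  have : (x - a) / ρ - 1 / 2 = (2 * (x - a) - ρ) / (2 * ρ) := by field_simp
  rw [this, div_le_iff₀ (by positivity)] at h1
  nlinarith

/-- `2 rampAt a ρ x ≤ max (2 (x - a) - 2ρ/3) 0`. [folklore] -/
theorem two_mul_rampAt_le_max {a ρ : ℝ} (hρ : 0 < ρ) (x : ℝ) : 2 * rampAt a ρ x ≤ max (2 * (x - a) - 2 * ρ / 3) 0 := by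
  rw [rampAt_apply]
  have h := stepRamp_le ((x - a) / ρ)
  rcases le_total ((x - a) / ρ - 1 / 3) 0 with hle | hle
  · rw [max_eq_right hle] at h
    have h0 : stepRamp ((x - a) / ρ) = 0 := le_antisymm h (stepRamp_nonneg _)
    rw [h0, mul_zero, mul_zero]
    exact le_max_right _ _
  · rw [max_eq_left hle] at h
    have : (x - a) / ρ - 1 / 3 = (2 * (x - a) - 2 * ρ / 3) / (2 * ρ) := by field_simp
    rw [this, le_div_iff₀ (by positivity)] at h
    refine le_trans ?_ (le_max_left _ _)
    nlinarith

/-- **The tent lies below the ideal corner**: `tent(u) ≤ min (c + (u - a)) (c + ρ - (u - a))`.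
[folklore] -/
theorem tentProfile_le_min {a c ρ : ℝ} (hρ : 0 < ρ) (u : ℝ) :
    tentProfile a c ρ u ≤ min (c + (u - a)) (c + ρ - (u - a)) := by
  rw [tentProfile_apply]
  have h := max_le_two_mul_rampAt (a := a) hρ u
  have h1 : 2 * (u - a) - ρ ≤ 2 * rampAt a ρ u := le_trans (le_max_left _ _) h
  have h2 : 0 ≤ 2 * rampAt a ρ u := le_trans (le_max_right _ _) h
  refine le_min ?_ ?_ <;> linarith

/-- **The tent lies above the ideal corner lowered by `ρ/3`**:
`min (c + (u - a)) (c + ρ - (u - a)) - ρ/3 ≤ tent(u)`. [folklore] -/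
theorem min_sub_le_tentProfile {a c ρ : ℝ} (hρ : 0 < ρ) (u : ℝ) :
    min (c + (u - a)) (c + ρ - (u - a)) - ρ / 3 ≤ tentProfile a c ρ u := by
  rw [tentProfile_apply]
  have h := two_mul_rampAt_le_max (a := a) hρ u
  rcases le_total (2 * (u - a) - 2 * ρ / 3) 0 with hle | hle
  · rw [max_eq_right hle] at h
    have := min_le_left (c + (u - a)) (c + ρ - (u - a))
    linarith
  · rw [max_eq_left hle] at h
    have := min_le_right (c + (u - a)) (c + ρ - (u - a))
    linarith

/-! ## The band of the tent -/

/-- **The band of the tent lies in two truncated straight strips** (frame coordinates): if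
`|v - tent(u)| ≤ w` then, with `w' = w + ρ/3`, either `|v - (c + (u - a))| ≤ w'` and
`v ≤ c + ρ - (u - a) + w` (incoming arm strip, truncated past the outgoing line), or
`|v - (c + ρ - (u - a))| ≤ w'` and `v ≤ c + (u - a) + w` (outgoing arm strip, truncated).
[folklore] -/
theorem tent_band_subset {a c ρ w u v : ℝ} (hρ : 0 < ρ) (h : |v - tentProfile a c ρ u| ≤ w) :
    (|v - (c + (u - a))| ≤ w + ρ / 3 ∧ v ≤ c + ρ - (u - a) + w) ∨
      (|v - (c + ρ - (u - a))| ≤ w + ρ / 3 ∧ v ≤ c + (u - a) + w) := by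
  have hle := tentProfile_le_min (a := a) (c := c) hρ u
  have hge := min_sub_le_tentProfile (a := a) (c := c) hρ u
  rw [abs_le] at h
  obtain ⟨h1, h2⟩ := h
  have hin : v ≤ c + (u - a) + w := by linarith [min_le_left (c + (u - a)) (c + ρ - (u - a))]
  have hout : v ≤ c + ρ - (u - a) + w := by linarith [min_le_right (c + (u - a)) (c + ρ - (u - a))]
  rcases le_total (c + (u - a)) (c + ρ - (u - a)) with hm | hm
  · left
    rw [min_eq_left hm] at hle hge
    refine ⟨abs_le.2 ⟨by linarith, by linarith⟩, hout⟩
  · right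
    rw [min_eq_right hm] at hle hge
    refine ⟨abs_le.2 ⟨by linarith, by linarith⟩, hin⟩

/-- **The band of a static corner in physical coordinates**: for the `E → S` corner with tent
data `(a, c, ρ)` (incoming horizontal arm `y = (c - a)/2`, outgoing vertical arm
`x = (a + ρ + c)/2`), a point with `|(x + y) - tent(x - y)| ≤ w` lies in the horizontal strip
`|y - (c - a)/2| ≤ (w + ρ/3)/2` truncated at `x ≤ (a + ρ + c)/2 + w/2`, or in the vertical strip
`|x - (a + ρ + c)/2| ≤ (w + ρ/3)/2` truncated at `y ≤ (c - a)/2 + w/2`. [folklore] -/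
theorem corner_band_subset {a c ρ w : ℝ} (hρ : 0 < ρ) {z : E²}
    (h : |(z 0 + z 1) - tentProfile a c ρ (z 0 - z 1)| ≤ w) :
    (|z 1 - (c - a) / 2| ≤ (w + ρ / 3) / 2 ∧ z 0 ≤ (a + ρ + c) / 2 + w / 2) ∨
      (|z 0 - (a + ρ + c) / 2| ≤ (w + ρ / 3) / 2 ∧ z 1 ≤ (c - a) / 2 + w / 2) := by
  rcases tent_band_subset (a := a) (c := c) hρ h with ⟨h1, h2⟩ | ⟨h1, h2⟩
  · left
    rw [abs_le] at h1 ⊢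
    obtain ⟨h1a, h1b⟩ := h1
    exact ⟨⟨by linarith, by linarith⟩, by linarith⟩
  · right
    rw [abs_le] at h1 ⊢
    obtain ⟨h1a, h1b⟩ := h1
    exact ⟨⟨by linarith, by linarith⟩, by linarith⟩

/-- **Where the moving corner scalar does not vanish**: if the profile vanishes off `(-r, r)`
and `κ > 0`, then `cornerScalar Gp (mcT a c ρ p q) (mcΞ κ p s) (mcΞx κ) t z ≠ 0` forces
`|(z₀ + z₁ - q(t)) - tent(z₀ - z₁ - p(t))| < κ r`. [folklore] -/
theorem abs_sub_tent_lt_of_movingCornerScalar_ne_zero {G : Type*} [NormedAddCommGroup G]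
    {Gp : ℝ → G} {a c ρ κ r : ℝ} {p q s : ℝ → ℝ} {t : ℝ} {z : E²} (hGp : ∀ x, Gp x ≠ 0 → |x| < r) (hκ : 0 < κ)
    (hne : cornerScalar Gp (mcT a c ρ p q) (mcΞ κ p s) (mcΞx κ) t z ≠ 0) :
    |(z 0 + z 1 - q t) - tentProfile a c ρ (z 0 - z 1 - p t)| < κ * r := by
  rw [cornerScalar_apply] at hne
  have h := hGp _ hne
  simp only [mcT, mcΞx] at h
  rw [abs_div, abs_of_pos hκ, div_lt_iff₀ hκ] at h
  have e : z 0 + z 1 - (tentProfile a c ρ (z 0 - z 1 - p t) + q t) =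
      z 0 + z 1 - q t - tentProfile a c ρ (z 0 - z 1 - p t) := by ring
  rw [e] at h
  linarith [mul_comm r κ]

/-- **The band of the moving corner in physical coordinates**: translate `corner_band_subset` by
`(p, q)`: with `u = z₀ - z₁ - p`, `v = z₀ + z₁ - q`, a point with `|v - tent(u)| ≤ w` lies in the
horizontal strip `|z₁ - (q - p + c - a)/2| ≤ (w + ρ/3)/2` truncated at
`z₀ ≤ (p + q + a + ρ + c)/2 + w/2`, or in the vertical strip
`|z₀ - (p + q + a + ρ + c)/2| ≤ (w + ρ/3)/2` truncated at `z₁ ≤ (q - p + c - a)/2 + w/2`.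
[folklore] -/
theorem movingCorner_band_subset {a c ρ w : ℝ} (hρ : 0 < ρ) {pt qt : ℝ} {z : E²}
    (h : |(z 0 + z 1 - qt) - tentProfile a c ρ (z 0 - z 1 - pt)| ≤ w) :
    (|z 1 - (qt - pt + c - a) / 2| ≤ (w + ρ / 3) / 2 ∧ z 0 ≤ (pt + qt + a + ρ + c) / 2 + w / 2) ∨
      (|z 0 - (pt + qt + a + ρ + c) / 2| ≤ (w + ρ / 3) / 2 ∧ z 1 ≤ (qt - pt + c - a) / 2 + w / 2) := by
  rcases tent_band_subset (a := a) (c := c) (u := z 0 - z 1 - pt) (v := z 0 + z 1 - qt) hρ h with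
    ⟨h1, h2⟩ | ⟨h1, h2⟩
  · left
    rw [abs_le] at h1 ⊢
    obtain ⟨h1a, h1b⟩ := h1
    exact ⟨⟨by linarith, by linarith⟩, by linarith⟩
  · right
    rw [abs_le] at h1 ⊢
    obtain ⟨h1a, h1b⟩ := h1
    exact ⟨⟨by linarith, by linarith⟩, by linarith⟩

/-- **The closed band of the moving corner** `{|v - T(t,u)| ≤ w}` is closed in space-time when
`p`, `q` are continuous. [folklore] -/
theorem isClosed_movingCornerBand {a c ρ w : ℝ} {p q : ℝ → ℝ} (hp : Continuous p) (hq : Continuous q) :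
    IsClosed {P : ℝ × E² | |(P.2 0 + P.2 1 - q P.1) - tentProfile a c ρ (P.2 0 - P.2 1 - p P.1)| ≤ w} := by
  have h0 : Continuous fun P : ℝ × E² => P.2 0 := (EuclideanSpace.proj (0 : Fin 2)).continuous.comp continuous_snd
  have h1 : Continuous fun P : ℝ × E² => P.2 1 := (EuclideanSpace.proj (1 : Fin 2)).continuous.comp continuous_snd
  have hT : Continuous (tentProfile a c ρ) := (tentProfile_contDiff (n := 0)).continuous
  refine isClosed_le ?_ continuous_const
  exact (((h0.add h1).sub (hq.comp continuous_fst)).sub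
    (hT.comp ((h0.sub h1).sub (hp.comp continuous_fst)))).abs

end PlanarKinematics

end Literature.Analysis.FluidPDE
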